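import Literature.NumberTheory.Transcendental.ZilberFieldQuasiminimal
import Literature.ModelTheory.Quasiminimal.PregeometryClasses
import HarnessLib

/-!
# Zilber's categoricity theorem: the architecture of the proof, in Lean

B. Zilber, *Pseudo-exponentiation on algebraically closed fields of characteristic zero*, Ann.
Pure Appl. Logic 132 (2005), Thm 1.1, with the complete proof of M. Bays, J. Kirby,
*Pseudo-exponential maps, variants, and quasiminimality*, Algebra & Number Theory 12 (2018),
Thm 1.2 = Thm 9.1 (and the note Bays–Kirby, arXiv:1305.0493, Thm 1): **up to isomorphism there
is exactly one model of Zilber's axioms `ECF_{SK,CCP}` of each uncountable cardinality**. The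
uniqueness half is the named fact `Literature.NumberTheory.Transcendental.zilber_categoricity` of
`ZilberField.lean` (for the tree's `IsZilberField`, which implies the five axioms of Bays–Kirby
2018, Thm 9.1: axiom 4 in the linear-independence form is
`IsStronglyExpAlgClosed.isLinIndepExpAlgClosed`, axiom 5 for finite sets is
`hasCountableClosureProperty_iff_finite`).

The printed proof has two halves of very different nature, and this file formalises the GLUE
between them, proving `zilber_categoricity` from the two halves taken as explicit hypotheses
(no named fact is introduced here; the two halves are the candidates for a split of the fact):

1. **Abstract model theory** (Haykazyan, J. Symbolic Logic 81 (2016), Thm 16; originally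
   Zilber 2005 + Kirby, JSL 75 (2010), Cor. 3.4 via Shelah's excellence, shown redundant by
   Bays–Hart–Hyttinen–Kesälä–Kirby 2014): in a *quasiminimal pregeometry class*
   (`Literature.ModelTheory.Quasiminimal.IsQuasiminimalPregeometryClass`, Haykazyan's Def. 2),
   bijections between bases of uncountable members extend to isomorphisms. Hypothesis `h16` below.
2. **Zilber fields form such a class** (Bays–Kirby 2013, Props 4–5 = Kirby's axioms 0, I, II for
   `ECF_{SK,CCP}` with Kirby's pregeometry `ecl`; complete proofs in Bays–Kirby 2018, Thm 6.9,
   Thm 8.1, §9.1; the pregeometry axioms are Kirby, Bull. LMS 42 (2010), Thm 1.1, discharged in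
   the tree: `Kirby2010_ecl_exchange_holds` etc.). Hypothesis `h𝒞` below.

Glue (`zilber_categoricity_of_isQuasiminimalPregeometryClass`, PROVED): Zilber fields `K`, `K'`
with `#K = #K' > ℵ₀` are members of the class; bases of `ecl` exist and have cardinality
`#K = #K'` (countable closure property), so they are in bijection; Theorem 16 gives an
isomorphism of structures `K ≃[L] K'`, which is an isomorphism of exponential rings because the
language contains the symbols `+, ·, exp` (`ExponentialRingEquiv.ofEclIsoEquiv`).

## The language: Galois types of exponential-algebraic closures

The axioms of quasiminimal pregeometry classes refer to quantifier-free types and partial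
embeddings, so the class of Zilber fields must be presented in a language in which
quantifier-free types are fine enough ("these axioms are rather sensitive to the choice of
language because they imply a form of quantifier elimination", Bays–Kirby 2013 §2.4; Kirby 2010,
p. 3: "this quantifier elimination must usually be obtained by first expanding the language",
and Prop. 3.5: Galois types over `∅` and over closed submodels equal quantifier-free types;
Bays–Kirby 2018, Remark 6.6: the language `L^{QE}` of Def. 6.7 is chosen so that quantifier-free
types are Galois types). We use the canonical language with this property for exponential fields
with Kirby's closure `ecl`, the **closure-isomorphism language** `Language.eclIso`: the function
symbols `+, ·, -, 0, 1, exp` of `Language.expRing` together with, for every `n` and every pointed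
exponential field `(T, t̄)` (`t̄ ∈ Tⁿ`, `T` in `Type`), an `n`-ary relation symbol `R_{(T,t̄)}`
interpreted in an exponential field `K` by

  `R_{(T,t̄)}(x̄) :⟺` there is an embedding of exponential rings `T → K` with image `ecl(x̄)`
  mapping `t̄ ↦ x̄`

(so `R_{(T,t̄)}(x̄)` says "`(ecl(x̄), x̄) ≅ (T, t̄)`"). Thus two tuples `x̄ ∈ Kⁿ`, `x̄' ∈ K'ⁿ` (with
`K` in `Type`) have the same quantifier-free `Language.eclIso`-type exactly when there is an
isomorphism of exponential fields `ecl^K(x̄) ≅ ecl^{K'}(x̄')` mapping `x̄ ↦ x̄'`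
(`exists_eHom_of_eqQFType₂`, `eqQFType₂_of_eHom`): the cross-field version of the back-and-forth relation
`EclIsoRel` of `ZilberFieldQuasiminimal.lean` and of the orbit language of
`Literature/ModelTheory/Quasiminimal/OrbitLanguage.lean`. In this language, partial embeddings
between CLOSED subsets are exactly isomorphisms of exponential fields between them, and all of
Haykazyan's axioms for the class of Zilber fields become statements about isomorphisms of
exponential fields between `ecl`-closed subfields of two Zilber fields (Kirby 2010, Thm 2.1 and
Prop. 3.5 for the class `ECF_{SK,CCP}`; Bays–Kirby 2013, Lemma 3, Props 4–5, Cor. 6).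

## Contents

* `PointedEField n`, `Language.eclIso`, `Language.eclIso.instStructure` (+ `funMap_*`,
  `relMap_iff`), `relMap_self`, `exists_eHom_of_eqQFType₂`; conversely `realize_term_eHom`,
  `relMap_comp_iff_of_eHom`, `eqQFType₂_of_eHom`.
* `ExponentialRingEquiv.ofEclIsoEquiv` — an `Language.eclIso`-isomorphism is an E-ring isomorphism.
* `ZilberClass` — the class of (universe-`0`) `Language.eclIso`-structures-with-closure arising
  from Zilber fields with `ecl`; `zilberClass_ecl`.
* `zilber_categoricity_of_isQuasiminimalPregeometryClass` — the glue theorem (proved).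

## References

* B. Zilber, Ann. Pure Appl. Logic 132 (2005) 67–95: Thm 1.1, §5.
* M. Bays, J. Kirby, Algebra & Number Theory 12 (2018) 493–549, arXiv:1512.04262: Thm 1.2,
  Def. 6.1–6.3, Fact 6.4, Remark 6.6, Thm 6.9, Thm 8.1, Thm 9.1.
* M. Bays, J. Kirby, *Excellence and uncountable categoricity of Zilber's exponential fields*,
  arXiv:1305.0493 (2013): Thm 1, §2.4, Lemma 3, Props 4–5, Cor. 6.
* L. Haykazyan, J. Symbolic Logic 81 (2016) 56–64, arXiv:1308.1892: Def. 2, Thm 16.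
* J. Kirby, J. Symbolic Logic 75 (2010) 551–564, arXiv:0707.4496: Def. 1.1, Thm 2.1, Cor. 3.4,
  Prop. 3.5.
* J. Kirby, Bull. London Math. Soc. 42 (2010) 879–890: Thm 1.1, Lemma 3.3.
-/

noncomputable section

open Set Cardinal
open FirstOrder FirstOrder.Language
open Literature.ModelTheory.ExponentialFields Literature.ModelTheory.Quasiminimal

namespace Literature.NumberTheory.Transcendental

/-! ### The closure-isomorphism language -/

/-- A **pointed exponential field**: an exponential field `T` (in `Type`) with an `n`-tuple `t̄`.
These index the `n`-ary relation symbols `R_{(T,t̄)}` of `Language.eclIso`. [folklore] -/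
structure PointedEField (n : ℕ) : Type 1 where
  /-- the field -/
  carrier : Type
  /-- its field structure -/
  [instField : Field carrier]
  /-- its exponential -/
  [instExp : ExponentialRing carrier]
  /-- the distinguished tuple -/
  pt : Fin n → carrier

/-- The field structure of a pointed exponential field. [folklore] -/
instance PointedEField.instFieldCarrier {n : ℕ} (T : PointedEField n) : Field T.carrier := T.instField

/-- The exponential of a pointed exponential field. [folklore] -/
instance PointedEField.instExpCarrier {n : ℕ} (T : PointedEField n) : ExponentialRing T.carrier :=
  T.instExp

/-- **The closure-isomorphism language** of exponential fields: function symbols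
`+, ·, -, 0, 1, exp` (`expRingFunc`) and an `n`-ary relation symbol for every pointed exponential
field `(T, t̄)`, `t̄ ∈ Tⁿ` — to be read "`(ecl(x̄), x̄)` is isomorphic to `(T, t̄)`". This is the
expansion of the language of exponential rings in which quantifier-free types of finite tuples are
the isomorphism types of their exponential-algebraic closures (Galois types; Kirby 2010,
Prop. 3.5; Bays–Kirby 2018, Remark 6.6). Full name
`Literature.NumberTheory.Transcendental.Language.eclIso`.
[cite: BaysKirby2018ANT, Remark 6.6 and Def. 6.7] -/
def Language.eclIso : Language.{0, 1} :=
  { Functions := expRingFunc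
    Relations := PointedEField }

section Structure

variable {K : Type*} [Field K] [ExponentialRing K]

/-- Every exponential field is a structure for the closure-isomorphism language: the function
symbols as in `Language.expRing`, and `R_{(T,t̄)}(x̄)` iff some embedding of exponential rings
`T → K` has image `ecl(x̄)` and maps `t̄ ↦ x̄`. [cite: BaysKirby2018ANT, Remark 6.6] -/
instance Language.eclIso.instStructure : Language.eclIso.Structure K where
  funMap
  | .add, v => v 0 + v 1
  | .mul, v => v 0 * v 1
  | .neg, v => -v 0
  | .zero, _ => 0
  | .one, _ => 1
  | .exp, v => ExponentialRing.exp (v 0)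
  RelMap := fun {n} (T : PointedEField n) (x : Fin n → K) =>
    ∃ φ : ExponentialRingHom T.carrier K, Set.range φ = ecl (Set.range x) ∧ ⇑φ ∘ T.pt = x

namespace Language.eclIso

/-- Interpretation of `+` (by `rfl`). [folklore] -/
@[simp] theorem funMap_add (v : Fin 2 → K) :
    Structure.funMap (L := Language.eclIso) expRingFunc.add v = v 0 + v 1 := rfl

/-- Interpretation of `·` (by `rfl`). [folklore] -/
@[simp] theorem funMap_mul (v : Fin 2 → K) :
    Structure.funMap (L := Language.eclIso) expRingFunc.mul v = v 0 * v 1 := rfl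

/-- Interpretation of `-` (by `rfl`). [folklore] -/
@[simp] theorem funMap_neg (v : Fin 1 → K) :
    Structure.funMap (L := Language.eclIso) expRingFunc.neg v = -v 0 := rfl

/-- Interpretation of `0` (by `rfl`). [folklore] -/
@[simp] theorem funMap_zero (v : Fin 0 → K) :
    Structure.funMap (L := Language.eclIso) expRingFunc.zero v = 0 := rfl

/-- Interpretation of `1` (by `rfl`). [folklore] -/
@[simp] theorem funMap_one (v : Fin 0 → K) :
    Structure.funMap (L := Language.eclIso) expRingFunc.one v = 1 := rfl

/-- Interpretation of `exp` (by `rfl`). [folklore] -/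
@[simp] theorem funMap_exp (v : Fin 1 → K) :
    Structure.funMap (L := Language.eclIso) expRingFunc.exp v = ExponentialRing.exp (v 0) := rfl

/-- Interpretation of the relation symbol `R_{(T,t̄)}` (by `Iff.rfl`). [folklore] -/
theorem relMap_iff {n : ℕ} (T : PointedEField n) (x : Fin n → K) :
    Structure.RelMap (L := Language.eclIso) T x ↔
      ∃ φ : ExponentialRingHom T.carrier K, Set.range φ = ecl (Set.range x) ∧ ⇑φ ∘ T.pt = x :=
  Iff.rfl

end Language.eclIso

/-- The pointed exponential field `(ecl(x̄), x̄)` of a tuple `x̄` from an exponential field `K` in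
`Type` (the E-subfield `Khovanskii.eclSubfield`, Kirby 2010 (EAEF), Lemma 3.3).
[cite: Kirby2010, Lemma 3.3] -/
def PointedEField.self {K : Type} [Field K] [ExponentialRing K] {n : ℕ} (x : Fin n → K) :
    PointedEField n where
  carrier := Khovanskii.eclSubfield (Set.range x)
  pt i := ⟨x i, subset_ecl _ (Set.mem_range_self i)⟩

/-- Every tuple satisfies its own relation symbol: `R_{(ecl(x̄), x̄)}(x̄)`. [folklore] -/
theorem relMap_self {K : Type} [Field K] [ExponentialRing K] {n : ℕ} (x : Fin n → K) :
    Structure.RelMap (L := Language.eclIso) (PointedEField.self x) x := by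
  refine ⟨Khovanskii.eclSubfield.eHom (Set.range x), ?_, funext fun i => rfl⟩
  ext a
  simp only [Set.mem_range]
  constructor
  · rintro ⟨b, rfl⟩; exact b.2
  · intro ha; exact ⟨⟨a, ha⟩, rfl⟩

/-- **Equal quantifier-free `Language.eclIso`-types give isomorphic closures**: if `x̄ ∈ Kⁿ` and
`x̄' ∈ K'ⁿ` (with `K` in `Type`) have the same quantifier-free type then there is an embedding of
exponential rings `ecl^K(x̄) → K'` with image `ecl^{K'}(x̄')` mapping `x̄ ↦ x̄'` — an isomorphism of
exponential fields `ecl(x̄) ≅ ecl(x̄')` over `x̄ ↦ x̄'` (apply type-equality to the atomic formula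
`R_{(ecl(x̄), x̄)}(v̄)`). This is how the categoricity proofs read the language: Galois types
(Kirby 2010, Prop. 3.5; Bays–Kirby 2018, Remark 6.6). [cite: Kirby2010QMEC, Prop. 3.5] -/
theorem exists_eHom_of_eqQFType₂ {K : Type} [Field K] [ExponentialRing K] {K' : Type*} [Field K']
    [ExponentialRing K'] {n : ℕ} {x : Fin n → K} {x' : Fin n → K'}
    (h : Language.eclIso.EqQFType₂ x x') :
    ∃ φ : ExponentialRingHom (Khovanskii.eclSubfield (Set.range x)) K',
      Set.range φ = ecl (Set.range x') ∧ ∀ i, φ ⟨x i, subset_ecl _ (Set.mem_range_self i)⟩ = x' i := by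
  have hat : BoundedFormula.IsAtomic
      (Relations.formula (L := Language.eclIso) (PointedEField.self x) fun i => var i) :=
    BoundedFormula.IsAtomic.rel _ _
  have key := (h _ hat).1 (by
    rw [Formula.realize_rel]
    simpa using relMap_self x)
  rw [Formula.realize_rel] at key
  simp only [Term.realize_var] at key
  obtain ⟨φ, hφ, hφx⟩ := (Language.eclIso.relMap_iff _ _).1 key
  exact ⟨φ, hφ, fun i => congr_fun hφx i⟩

/-! ### Quantifier-free types in `Language.eclIso` are isomorphism types of closures -/

/-- **Morphisms of exponential rings commute with the evaluation of `Language.eclIso`-terms**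
(the terms are the exponential-ring terms `+, ·, -, 0, 1, exp`). [folklore] -/
theorem realize_term_eHom {R S : Type*} [Field R] [ExponentialRing R] [Field S] [ExponentialRing S]
    (ψ : ExponentialRingHom R S) {α : Type*} (t : Language.eclIso.Term α) (v : α → R) :
    ψ (t.realize v) = t.realize (⇑ψ ∘ v) := by
  induction t with
  | var a => rfl
  | func f ts ih =>
    cases f with
    | add =>
      simp only [Term.realize, Language.eclIso.funMap_add]
      rw [map_add, ih 0, ih 1]
    | mul =>
      simp only [Term.realize, Language.eclIso.funMap_mul]
      rw [map_mul, ih 0, ih 1]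
    | neg =>
      simp only [Term.realize, Language.eclIso.funMap_neg]
      rw [map_neg, ih 0]
    | zero =>
      simp only [Term.realize, Language.eclIso.funMap_zero]
      exact map_zero ψ
    | one =>
      simp only [Term.realize, Language.eclIso.funMap_one]
      exact map_one ψ
    | exp =>
      simp only [Term.realize, Language.eclIso.funMap_exp]
      rw [ExponentialRingHom.map_exp, ih 0]

section Converse

variable {K : Type} [Field K] [ExponentialRing K] {K' : Type*} [Field K'] [ExponentialRing K']

/-- Closures of subsets of `ecl S`, computed in `K`, stay inside `ecl S`. [cite: Kirby2010, Lemma 3.3] -/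
theorem ecl_subset_ecl_of_subset {K : Type*} [Field K] [ExponentialRing K] {S T : Set K}
    (hT : T ⊆ ecl S) : ecl T ⊆ ecl S := by
  have := ecl_mono (K := K) hT
  rwa [Khovanskii.ecl_ecl] at this

/-- An embedding of exponential rings out of `ecl(S) ≤ K` whose image is `ecl(S') ⊆ K'`
co-restricts to an isomorphism of exponential fields `ecl(S) ≅ ecl(S')` (fields in any universes).
[folklore] -/
def eclEquivOfEHom {K : Type*} [Field K] [ExponentialRing K] {S : Set K} {S' : Set K'}
    (φ : ExponentialRingHom (Khovanskii.eclSubfield S) K') (hφ : Set.range φ = ecl S') :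
    ExponentialRingEquiv (Khovanskii.eclSubfield S) (Khovanskii.eclSubfield S') :=
  have hmem : ∀ z : Khovanskii.eclSubfield S, φ z ∈ Khovanskii.eclSubfield S' := fun z => by
    change φ z ∈ ecl S'
    rw [← hφ]; exact ⟨z, rfl⟩
  have hbij : Function.Bijective (φ.toRingHom.codRestrict (Khovanskii.eclSubfield S') hmem) := by
    refine ⟨fun z w h => φ.toRingHom.injective (congr_arg Subtype.val h :), fun w => ?_⟩
    have : (w : K') ∈ Set.range φ := by rw [hφ]; exact w.2
    obtain ⟨z, hz⟩ := this
    exact ⟨z, Subtype.ext hz⟩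
  { RingEquiv.ofBijective (φ.toRingHom.codRestrict (Khovanskii.eclSubfield S') hmem) hbij with
    map_exp' := fun z => Subtype.ext (by
      change (φ (ExponentialRing.exp z) : K') = ExponentialRing.exp (φ z : K')
      exact φ.map_exp z) }

/-- `eclEquivOfEHom φ hφ` is `φ` on coordinates. [folklore] -/
@[simp] theorem coe_eclEquivOfEHom_apply {K : Type*} [Field K] [ExponentialRing K] {S : Set K} {S' : Set K'}
    (φ : ExponentialRingHom (Khovanskii.eclSubfield S) K') (hφ : Set.range φ = ecl S')
    (z : Khovanskii.eclSubfield S) : ((eclEquivOfEHom φ hφ z : Khovanskii.eclSubfield S') : K') = φ z :=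
  rfl

/-- **`ecl` along an embedding with `ecl`-closed image**: for `φ : ecl(S) → K'` with image
`ecl(S')` and a tuple `u` from `ecl(S)`, `ecl^{K'}(φ u) = φ(ecl^{ecl S}(u))` — `ecl` is computed
inside `ecl`-closed E-subfields (`Khovanskii.eclSubfield.image_ecl`) and is transported by
isomorphisms of exponential fields (`Khovanskii.image_ecl_equiv`). [cite: Kirby2010QMEC, Lemma 1.3] -/
theorem ecl_range_comp_eHom {K : Type*} [Field K] [ExponentialRing K] {S : Set K} {S' : Set K'}
    (φ : ExponentialRingHom (Khovanskii.eclSubfield S) K') (hφ : Set.range φ = ecl S')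
    {ι : Type*} (u : ι → Khovanskii.eclSubfield S) :
    ecl (Set.range (⇑φ ∘ u)) = φ '' ecl (Set.range u) := by
  have e1 : ⇑φ ∘ u = Subtype.val ∘ (⇑(eclEquivOfEHom φ hφ) ∘ u) := funext fun i => rfl
  have e2 : (⇑φ : Khovanskii.eclSubfield S → K') = Subtype.val ∘ ⇑(eclEquivOfEHom φ hφ) :=
    funext fun z => rfl
  rw [e1, Set.range_comp Subtype.val, ← Khovanskii.eclSubfield.image_ecl, Set.range_comp,
    ← Khovanskii.image_ecl_equiv, e2, Set.image_comp]

/-- `ecl` of a tuple from `ecl(S)`, computed in `K`, is the image of its `ecl` computed in the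
E-subfield `ecl(S)`. [cite: Kirby2010QMEC, Lemma 1.3] -/
theorem ecl_range_comp_val {K : Type*} [Field K] [ExponentialRing K] {S : Set K} {ι : Type*}
    (u : ι → Khovanskii.eclSubfield S) :
    ecl (Set.range (Subtype.val ∘ u)) = Subtype.val '' ecl (Set.range u) := by
  rw [Set.range_comp, Khovanskii.eclSubfield.image_ecl]

/-- **The relation symbols of `Language.eclIso` are invariant under embeddings of `ecl`-closed
exponential subfields**: for an embedding of exponential rings `φ : ecl(S) → K'` whose image is
`ecl(S')`, and a tuple `u` from `ecl(S)`, `R_{(T,t̄)}(u)` holds in `K` iff `R_{(T,t̄)}(φ u)` holds in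
`K'` — both say `(ecl(u), u) ≅ (T, t̄)`, and `φ` restricts to an isomorphism
`ecl^K(u) ≅ ecl^{K'}(φ u)`. [cite: Kirby2010QMEC, Lemma 1.3] -/
theorem relMap_comp_iff_of_eHom {S : Set K} {S' : Set K'}
    (φ : ExponentialRingHom (Khovanskii.eclSubfield S) K') (hφ : Set.range φ = ecl S')
    {k : ℕ} (T : PointedEField k) (u : Fin k → Khovanskii.eclSubfield S) :
    Structure.RelMap (L := Language.eclIso) T (Subtype.val ∘ u) ↔
      Structure.RelMap (L := Language.eclIso) T (⇑φ ∘ u) := by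
  have hφinj : Function.Injective φ := φ.toRingHom.injective
  have hKF := ecl_range_comp_val u
  have hK'F := ecl_range_comp_eHom φ hφ u
  rw [Language.eclIso.relMap_iff, Language.eclIso.relMap_iff]
  constructor
  · rintro ⟨ψ, hψ, hψt⟩
    -- `ψ` lands in `ecl S`
    have hψF : ∀ z, ψ z ∈ Khovanskii.eclSubfield S := fun z => by
      have : ψ z ∈ ecl (Set.range (Subtype.val ∘ u)) := by rw [← hψ]; exact ⟨z, rfl⟩
      rw [hKF] at this
      obtain ⟨c, -, hc⟩ := this
      rw [← hc]; exact c.2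
    let ψ₀ : ExponentialRingHom T.carrier (Khovanskii.eclSubfield S) :=
      { ψ.toRingHom.codRestrict (Khovanskii.eclSubfield S) hψF with
        map_exp' := fun z => Subtype.ext (ψ.map_exp z) }
    have hψ₀ : ∀ z, ((ψ₀ z : Khovanskii.eclSubfield S) : K) = ψ z := fun z => rfl
    have hrange : Set.range ψ₀ = ecl (Set.range u) := by
      ext c
      constructor
      · rintro ⟨z, rfl⟩
        have : (ψ₀ z : K) ∈ Subtype.val '' ecl (Set.range u) := by
          rw [← hKF, hψ₀, ← hψ]; exact ⟨z, rfl⟩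
        obtain ⟨c, hc, hcz⟩ := this
        rwa [← Subtype.ext hcz]
      · intro hc
        have : (c : K) ∈ ecl (Set.range (Subtype.val ∘ u)) := by rw [hKF]; exact ⟨c, hc, rfl⟩
        rw [← hψ] at this
        obtain ⟨z, hz⟩ := this
        exact ⟨z, Subtype.ext (by rw [hψ₀, hz])⟩
    refine ⟨φ.comp ψ₀, ?_, ?_⟩
    · rw [hK'F, ← hrange, ← Set.range_comp]; rfl
    · funext i
      have hi : ψ (T.pt i) = (u i : K) := congr_fun hψt i
      have : ψ₀ (T.pt i) = u i := Subtype.ext (by rw [hψ₀, hi])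
      change φ (ψ₀ (T.pt i)) = φ (u i)
      rw [this]
  · rintro ⟨ψ', hψ', hψ't⟩
    -- `ψ'` lands in `φ(ecl S)`; pull it back along `φ`
    have hψ'φ : ∀ z, ∃ a : Khovanskii.eclSubfield S, φ a = ψ' z := fun z => by
      have : ψ' z ∈ ecl (Set.range (⇑φ ∘ u)) := by rw [← hψ']; exact ⟨z, rfl⟩
      rw [hK'F] at this
      obtain ⟨a, -, ha⟩ := this
      exact ⟨a, ha⟩
    choose ρ hρ using hψ'φ
    have hρ1 : ρ 1 = 1 := hφinj (by rw [hρ, map_one, map_one])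
    have hρ0 : ρ 0 = 0 := hφinj (by rw [hρ, map_zero, map_zero])
    have hρa : ∀ z w, ρ (z + w) = ρ z + ρ w := fun z w =>
      hφinj (by rw [map_add, hρ, hρ, hρ, map_add])
    have hρm : ∀ z w, ρ (z * w) = ρ z * ρ w := fun z w =>
      hφinj (by rw [map_mul, hρ, hρ, hρ, map_mul])
    have hρe : ∀ z, ρ (ExponentialRing.exp z) = ExponentialRing.exp (ρ z) := fun z =>
      hφinj (by rw [hρ, φ.map_exp, hρ, ψ'.map_exp])
    let ρ₀ : ExponentialRingHom T.carrier (Khovanskii.eclSubfield S) :=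
      { toFun := ρ
        map_one' := hρ1
        map_mul' := hρm
        map_zero' := hρ0
        map_add' := hρa
        map_exp' := hρe }
    have hρ₀ : ∀ z, ρ₀ z = ρ z := fun z => rfl
    have hrange : Set.range ρ₀ = ecl (Set.range u) := by
      ext c
      constructor
      · rintro ⟨z, rfl⟩
        have : φ (ρ₀ z) ∈ φ '' ecl (Set.range u) := by rw [← hK'F, hρ₀, hρ, ← hψ']; exact ⟨z, rfl⟩
        obtain ⟨c, hc, hcz⟩ := this
        rwa [← hφinj hcz]
      · intro hc
        have : φ c ∈ ecl (Set.range (⇑φ ∘ u)) := by rw [hK'F]; exact ⟨c, hc, rfl⟩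
        rw [← hψ'] at this
        obtain ⟨z, hz⟩ := this
        exact ⟨z, by rw [hρ₀]; exact hφinj (by rw [hρ, hz])⟩
    refine ⟨(Khovanskii.eclSubfield.eHom S).comp ρ₀, ?_, ?_⟩
    · rw [hKF, ← hrange, ← Set.range_comp]; rfl
    · funext i
      have hi : ψ' (T.pt i) = φ (u i) := congr_fun hψ't i
      have : ρ₀ (T.pt i) = u i := by rw [hρ₀]; exact hφinj (by rw [hρ, hi])
      change ((ρ₀ (T.pt i) : Khovanskii.eclSubfield S) : K) = u i
      rw [this]

/-- **Isomorphic closures give equal quantifier-free `Language.eclIso`-types** (converse of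
`exists_eHom_of_eqQFType₂`): if an embedding of exponential rings `φ : ecl^K(x̄) → K'` has image
`ecl^{K'}(x̄')` and maps `x̄ ↦ x̄'`, then `qftp(x̄) = qftp(x̄')`. Terms are evaluated inside the
E-subfield `ecl(x̄)` and transported by `φ` (`realize_term_eHom`); relation symbols are invariant
(`relMap_comp_iff_of_eHom`). Together: in `Language.eclIso`, quantifier-free types of finite tuples
ARE the isomorphism types of their pointed exponential-algebraic closures (Galois types; Kirby
2010, Prop. 3.5; Bays–Kirby 2018, Remark 6.6). [cite: Kirby2010QMEC, Prop. 3.5] -/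
theorem eqQFType₂_of_eHom {n : ℕ} {x : Fin n → K} {x' : Fin n → K'}
    (φ : ExponentialRingHom (Khovanskii.eclSubfield (Set.range x)) K')
    (hφ : Set.range φ = ecl (Set.range x'))
    (hφx : ∀ i, φ ⟨x i, subset_ecl _ (Set.mem_range_self i)⟩ = x' i) :
    Language.eclIso.EqQFType₂ x x' := by
  set F := Khovanskii.eclSubfield (Set.range x) with hF
  let x₀ : Fin n → F := fun i => ⟨x i, subset_ecl _ (Set.mem_range_self i)⟩
  have hx : x = Subtype.val ∘ x₀ := funext fun i => rfl
  have hx' : x' = ⇑φ ∘ x₀ := funext fun i => (hφx i).symm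
  -- the valuations of bounded formulas with no bound variables
  have hv : (Sum.elim x (default : Fin 0 → K)) =
      ⇑(Khovanskii.eclSubfield.eHom (Set.range x)) ∘ Sum.elim x₀ (default : Fin 0 → F) := by
    funext s; rcases s with i | j
    · rfl
    · exact j.elim0
  have hv' : (Sum.elim x' (default : Fin 0 → K')) = ⇑φ ∘ Sum.elim x₀ (default : Fin 0 → F) := by
    funext s; rcases s with i | j
    · simp [hx']
    · exact j.elim0
  intro ψf hψf
  change BoundedFormula.Realize ψf x default ↔ BoundedFormula.Realize ψf x' default
  cases hψf with
  | equal t₁ t₂ =>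
    simp only [BoundedFormula.realize_bdEqual]
    rw [hv, hv', ← realize_term_eHom, ← realize_term_eHom, ← realize_term_eHom,
      ← realize_term_eHom]
    have hφinj : Function.Injective φ := φ.toRingHom.injective
    simp only [Khovanskii.eclSubfield.eHom_apply]
    rw [Subtype.val_injective.eq_iff, hφinj.eq_iff]
  | rel R ts =>
    simp only [BoundedFormula.realize_rel]
    rw [hv, hv']
    have e1 : (fun i => (ts i).realize (⇑(Khovanskii.eclSubfield.eHom (Set.range x)) ∘
        Sum.elim x₀ default)) = Subtype.val ∘ fun i => (ts i).realize (Sum.elim x₀ default) := by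
      funext i
      simp only [Function.comp_apply, ← realize_term_eHom, Khovanskii.eclSubfield.eHom_apply]
    have e2 : (fun i => (ts i).realize (⇑φ ∘ Sum.elim x₀ default)) =
        ⇑φ ∘ fun i => (ts i).realize (Sum.elim x₀ default) := by
      funext i
      simp only [Function.comp_apply, ← realize_term_eHom]
    rw [e1, e2]
    exact relMap_comp_iff_of_eHom φ hφ R _

end Converse

end Structure

/-! ### Isomorphisms in the closure-isomorphism language are isomorphisms of exponential fields -/

section Equiv

variable {K K' : Type*} [Field K] [ExponentialRing K] [Field K'] [ExponentialRing K']

/-- **A `Language.eclIso`-isomorphism is an isomorphism of exponential rings** (the language has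
the function symbols `+`, `·`, `exp`). [folklore] -/
def ExponentialRingEquiv.ofEclIsoEquiv (e : K ≃[Language.eclIso] K') : ExponentialRingEquiv K K' where
  toEquiv := e.toEquiv
  map_mul' a b := by
    change e (a * b) = e a * e b
    simpa using e.map_fun expRingFunc.mul ![a, b]
  map_add' a b := by
    change e (a + b) = e a + e b
    simpa using e.map_fun expRingFunc.add ![a, b]
  map_exp' a := by
    change e (ExponentialRing.exp a) = ExponentialRing.exp (e a)
    simpa using e.map_fun expRingFunc.exp ![a]

/-- `ofEclIsoEquiv e` is `e` as a function. [folklore] -/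
@[simp] theorem ExponentialRingEquiv.ofEclIsoEquiv_apply (e : K ≃[Language.eclIso] K') (a : K) :
    ExponentialRingEquiv.ofEclIsoEquiv e a = e a := rfl

end Equiv

/-! ### The class of Zilber fields -/

/-- **The class of Zilber fields**, as a class of `Language.eclIso`-structures-with-closure on types
of `Type` (the universe of `zilber_categoricity`): `⟨H, cl⟩` is in the class iff `H` carries a
field structure of characteristic zero with an exponential making it a Zilber field
(`IsZilberField`, the models of `ECF_{SK,CCP}`), inducing the given `Language.eclIso`-structure, and
with `cl` Kirby's exponential-algebraic closure `ecl` (Zilber 2005 §5; Bays–Kirby 2013 §2.1, §2.4;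
Kirby 2010 (EAEF) Def. 1.1). [cite: BaysKirby2013Excellence, §2.1 and §2.4] -/
def ZilberClass : ∀ (H : Type) [Language.eclIso.Structure H], (Set H → Set H) → Prop :=
  fun H inst cl => ∃ (iF : Field H) (_ : CharZero H) (iE : ExponentialRing H),
    IsZilberField H ∧ @Language.eclIso.instStructure H iF iE = inst ∧ cl = @ecl H iF iE

/-- A Zilber field, with its canonical `Language.eclIso`-structure and `ecl`, is in the class.
[folklore] -/
theorem zilberClass_ecl {K : Type} [Field K] [CharZero K] [ExponentialRing K]
    (hK : IsZilberField K) : ZilberClass K ecl :=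
  ⟨_, ‹_›, _, hK, rfl, rfl⟩

/-! ### The glue: Zilber's categoricity theorem from the two halves -/

/-- **Zilber's categoricity theorem from its two printed halves.** Suppose
(`h𝒞`, Bays–Kirby 2013, Props 4–5 / Bays–Kirby 2018, Thms 6.9, 8.1, 9.1) that the class of
Zilber fields with `ecl`, in the closure-isomorphism language, is a quasiminimal pregeometry class
in the sense of Haykazyan's Def. 2, and (`h16`, Haykazyan 2016, Thm 16) that in this class every
bijection between bases of two uncountable members extends to an isomorphism. Then two Zilber
fields of the same uncountable cardinality are isomorphic as exponential fields
(`zilber_categoricity`; Zilber 2005, Thm 1.1; Bays–Kirby 2018, Thm 1.2 = Thm 9.1): both are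
members of the class (`zilberClass_ecl`), bases of `ecl` are equinumerous with the fields
(`IsPregeometry.mk_eq_mk_of_cl_eq_univ`, countable closure property), and the resulting
`Language.eclIso`-isomorphism is an isomorphism of exponential rings
(`ExponentialRingEquiv.ofEclIsoEquiv`).
[cite: Zilber2005PseudoExp, Thm 1.1] [cite: BaysKirby2018ANT, Thm 9.1]
[cite: Haykazyan2016, Theorem 16] -/
theorem zilber_categoricity_of_isQuasiminimalPregeometryClass
    (h𝒞 : IsQuasiminimalPregeometryClass Language.eclIso ZilberClass)
    (h16 : ∀ {H H' : Type} [Language.eclIso.Structure H] [Language.eclIso.Structure H']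
      {cl : Set H → Set H} {cl' : Set H' → Set H'}, ZilberClass H cl → ZilberClass H' cl' →
      Uncountable H → Uncountable H' →
      ∀ (B : Set H) (B' : Set H'), ClIndep cl B → cl B = Set.univ → ClIndep cl' B' →
        cl' B' = Set.univ → ∀ e : B ≃ B', ∃ f : H ≃[Language.eclIso] H', ∀ b : B, f b = e b) :
    zilber_categoricity := by
  intro K K' _ _ _ _ _ _ hK hK' hcard hunc
  haveI : Uncountable K := aleph0_lt_mk_iff.1 hunc
  obtain ⟨e⟩ := h𝒞.nonempty_equiv_of_mk_eq h16 (zilberClass_ecl hK) (zilberClass_ecl hK') hcard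
  exact ⟨ExponentialRingEquiv.ofEclIsoEquiv e⟩

end Literature.NumberTheory.Transcendental

end
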